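import Summits.Ventures.PercRepro.Night2HitLoad

/-!
# night-2: THE UNLOADED LEVELS BY THE LINES THROUGH THE BASIS (gen 39)

A loaded target `Q ∪ Y` contains a rank-2 set `R ⊆ T′` with `|R| ≥ |Y|`, and `R` meets the basis `Q′` in `r ≤ 2` points; the
line of `R` is then a basis line (`r = 2`), a line through one basis point and a point of `Y` (`r = 1`) or a line through two
points of `Y` (`r = 0`), carrying `≥ |Y| − r` points of `Y`.  Hence, with `L₂ / L₁ / L₀` bounding the points of `W` on the lines
with two / one / no basis point: **`dload_eq_zero_of_level_of_three_lines_le`** — every target with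
`|Y| ≥ L₂ + 3`, `|Y| ≥ L₁ + 2` and `|Y| ≥ L₀ + 1` is unloaded.  (The line lemma of Night2HitLoad is the case
`L₂ = L₁ = L₀ = L`; when the long lines of `W` avoid the basis this certifies two levels more.)  Paper: proofs/NIGHT-2-g39.md §7.
-/

namespace PercRepro.Shadow

open PercRepro.ThmH PercRepro.PerFlat

variable {α : Type*} [DecidableEq α] {M : Matroid α} [M.Finite] {G : Finset α}

/-- **The unloaded levels by the lines through the basis.** -/
theorem dload_eq_zero_of_level_of_three_lines_le (hG : G ∈ flatsQ M (5 + 1)) (hd : (gr M \ G).card = 2)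
    (hk : kColoops M G = 1) (hs : ∀ e ∈ gr M, ∀ f ∈ gr M, e ≠ f → rkN M {e, f} = 2)
    (hl : ∀ e ∈ gr M, M.Indep {e}) (hfat : (fatClosures M 5 G 2).card ≤ 1) {B : Finset α}
    (hB : B ∈ thinMembers M 5 G) (hnP : ¬ bigP M G B) {z : α} (hz : z ∈ G \ clF M B) {L₂ L₁ L₀ : ℕ}
    (h2 : ∀ a ∈ insert z B \ coloops M G, ∀ b ∈ insert z B \ coloops M G, a ≠ b →
      ((G \ insert z B) ∩ clF M {a, b}).card ≤ L₂)
    (h1 : ∀ a ∈ insert z B \ coloops M G, ∀ y ∈ G \ insert z B, ((G \ insert z B) ∩ clF M {a, y}).card ≤ L₁)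
    (h0 : ∀ x ∈ G \ insert z B, ∀ y ∈ G \ insert z B, x ≠ y → ((G \ insert z B) ∩ clF M {x, y}).card ≤ L₀)
    {Y : Finset α} (hY : Y ⊆ G \ insert z B) (hi2 : L₂ + 3 ≤ Y.card) (hi1 : L₁ + 2 ≤ Y.card)
    (hi0 : L₀ + 1 ≤ Y.card) :
    dload M 5 G (bigP M G) (dshGT2 M 5 G) (insert z B ∪ Y) = 0 := by
  by_contra hne
  obtain ⟨R, hRT, hR2, hcard⟩ := exists_rank_two_of_dload_ne_zero hG hd hk hs hl hfat hne
  have hGg : G ⊆ gr M := (mem_flatsQ.1 hG).1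
  have hBG : B ⊆ G := subset_G_of_mem_thinMembers hB
  have hQG : insert z B ⊆ G := Finset.insert_subset (Finset.mem_sdiff.1 hz).1 hBG
  have hT'K := union_sdiff_coloops_eq_of_subset hG hd hB (z := z) hY
  have hcardT := card_union_sdiff_coloops_eq hG hd hk hB hnP hz hY
  have hind : M.Indep ((insert z B \ coloops M G : Finset α) : Set α) :=
    (indep_insert_of_basis_pair hG hd hk hB hnP hz).subset (by exact_mod_cast (Finset.sdiff_subset))
  have hRQ' : (R ∩ (insert z B \ coloops M G)).card ≤ 2 := by
    rw [Finset.inter_comm]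
    exact card_inter_le_two_of_indep_of_rkN_le_two hind hR2.le
  have hRg : R ⊆ gr M :=
    hRT.trans (Finset.sdiff_subset.trans ((Finset.union_subset hQG (hY.trans Finset.sdiff_subset)).trans hGg))
  have hRsub : R ⊆ (R ∩ (insert z B \ coloops M G)) ∪ (R ∩ Y) := by
    intro r hr
    have hrT := hRT hr
    rw [hT'K, Finset.mem_union] at hrT
    rcases hrT with h | h
    · exact Finset.mem_union_left _ (Finset.mem_inter.2 ⟨hr, h⟩)
    · exact Finset.mem_union_right _ (Finset.mem_inter.2 ⟨hr, h⟩)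
  have hRY : Y.card ≤ (R ∩ (insert z B \ coloops M G)).card + (R ∩ Y).card := by
    have h1' := Finset.card_le_card hRsub
    have h2' := Finset.card_union_le (R ∩ (insert z B \ coloops M G)) (R ∩ Y)
    omega
  -- the pair that spans the line of `R`
  have hpairg : ∀ u v : α, u ∈ G → v ∈ G → ({u, v} : Finset α) ⊆ gr M := by
    intro u v hu hv e he
    rw [Finset.mem_insert, Finset.mem_singleton] at he
    rcases he with rfl | rfl
    · exact hGg hu
    · exact hGg hv
  have hline : ∀ u v : α, u ∈ G → v ∈ G → u ≠ v → u ∈ R → v ∈ R → R ⊆ clF M {u, v} := by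
    intro u v hu hv huv huR hvR
    exact subset_clF_of_rkN_le_two_of_two_mem hs hRg hR2.le huR hvR huv
      (subset_clF_of_subset_gr (hpairg u v hu hv) (Finset.mem_insert_self _ _))
      (subset_clF_of_subset_gr (hpairg u v hu hv) (Finset.mem_insert_of_mem (Finset.mem_singleton_self _)))
  have hWmem : ∀ y ∈ Y, y ∈ G := fun y hy => (Finset.mem_sdiff.1 (hY hy)).1
  have hQmem : ∀ a ∈ insert z B \ coloops M G, a ∈ G := fun a ha => hQG (Finset.mem_sdiff.1 ha).1
  have hRYsub : ∀ u v : α, R ⊆ clF M {u, v} → R ∩ Y ⊆ (G \ insert z B) ∩ clF M {u, v} := fun u v hsub r hr =>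
    Finset.mem_inter.2 ⟨hY (Finset.mem_inter.1 hr).2, hsub (Finset.mem_inter.1 hr).1⟩
  rcases Nat.lt_or_ge (R ∩ (insert z B \ coloops M G)).card 1 with hr0 | hr1
  · -- no basis point on the line: two points of `Y` span it
    have hRY2 : 2 ≤ (R ∩ Y).card := by omega
    obtain ⟨x, hx, y, hy, hxy⟩ := Finset.one_lt_card.1 hRY2
    have hsub := hline x y (hWmem x (Finset.mem_inter.1 hx).2) (hWmem y (Finset.mem_inter.1 hy).2) hxy
      (Finset.mem_inter.1 hx).1 (Finset.mem_inter.1 hy).1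
    have hc := Finset.card_le_card (hRYsub x y hsub)
    have hb := h0 x (hY (Finset.mem_inter.1 hx).2) y (hY (Finset.mem_inter.1 hy).2) hxy
    omega
  · rcases Nat.lt_or_ge (R ∩ (insert z B \ coloops M G)).card 2 with hr1' | hr2
    · -- one basis point `a` and a point `y` of `Y` span it
      obtain ⟨a, ha⟩ := Finset.card_pos.1 (show 0 < (R ∩ (insert z B \ coloops M G)).card by omega)
      have hRY1 : 1 ≤ (R ∩ Y).card := by omega
      obtain ⟨y, hy⟩ := Finset.card_pos.1 (show 0 < (R ∩ Y).card by omega)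
      have hay : a ≠ y := by
        intro h
        subst h
        exact (Finset.mem_sdiff.1 (hY (Finset.mem_inter.1 hy).2)).2 (Finset.mem_sdiff.1 (Finset.mem_inter.1 ha).2).1
      have hsub := hline a y (hQmem a (Finset.mem_inter.1 ha).2) (hWmem y (Finset.mem_inter.1 hy).2) hay
        (Finset.mem_inter.1 ha).1 (Finset.mem_inter.1 hy).1
      have hc := Finset.card_le_card (hRYsub a y hsub)
      have hb := h1 a (Finset.mem_inter.1 ha).2 y (hY (Finset.mem_inter.1 hy).2)
      omega
    · -- two basis points `a ≠ b` span it
      obtain ⟨a, ha, b, hb, hab⟩ := Finset.one_lt_card.1 (show 1 < (R ∩ (insert z B \ coloops M G)).card by omega)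
      have hsub := hline a b (hQmem a (Finset.mem_inter.1 ha).2) (hQmem b (Finset.mem_inter.1 hb).2) hab
        (Finset.mem_inter.1 ha).1 (Finset.mem_inter.1 hb).1
      have hc := Finset.card_le_card (hRYsub a b hsub)
      have hb' := h2 a (Finset.mem_inter.1 ha).2 b (Finset.mem_inter.1 hb).2 hab
      omega

end PercRepro.Shadow
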